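import Literature.Analysis.Matrix.LocalisedVariation
import Literature.Analysis.Matrix.TraceInvMulMixedDifference
import Literature.Analysis.Matrix.LogDetMixedDifferenceLocallySummed
import HarnessLib

/-!
# `ΔΔ tr(K⁻¹H)` over a rectangle, END TO END from two LOCAL matrix-valued maps and four LOCALISED configurations
# (the composition `LocalisedVariation` ⊕ `TraceInvMulMixedDifference`: locality + localised response ⟹ the summed rows ⟹ the bound)

Topic `Literature/Analysis/Matrix`; namespace `Literature.Analysis.Matrix`.  Sequel of `TraceInvMulMixedDifference.lean` (the card-free
rectangle `abs_fourPt_trace_inv_mul_le_of_summedProfiles` under SUMMED rows), `LocalisedVariation.lean` (locality + localised displacement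
⟹ pointwise profile rows) and `LogDetMixedDifferenceLocallySummed.lean` (`sum_sum_abs_le_of_twoProfile_range`).  Everything here is PROVED;
no definitions, no named facts.

THE POINT.  In the one-loop application the four matrices are VALUES `K(U i j)`, `H(U i j)` of two LOCAL maps of the configuration (the
Hessian of a finite-range action, the Hessian of a local observable) at the four backgrounds `U₀₀, U₁₀, U₀₁, U₁₁` of a coarse square, and the
backgrounds RESPOND to the two moves with exponential tails ([Balaban1985Variational] Thm 1 (10) p. 279): `U₁₀ − U₀₀`, `U₁₁ − U₀₁` localised
near the first bond (profile `d`, size `δ·s`), `U₀₁ − U₀₀`, `U₁₁ − U₁₀` near the second (`d′`, `δ·t`), and the MIXED response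
`U₁₁ − U₁₀ − U₀₁ + U₀₀` near both (`μ·s·t·e^{−θ(d + d′)}`).  This file derives every variation row of the rectangle theorem from those five
displacement rows and the locality of the two maps (first order `L`, second order `L₂`, radius `r`, values of range `r`), so that the
one-loop trace bound reads END TO END:
* §1 `rowSum_le_of_profile_range`, `colSum_le_of_profile_range` — a pointwise row-profile bound + range `r` + ball count `V` ⟹ ROW sums
  `≤ ε·V·e^{−θp}` and COLUMN sums `≤ ε·V·e^{θr}·e^{−θp}` (the profile moves to the column index at the price `e^{θr}`).
* §2 `sum_ball_abs_le_twoProfile`, ★`abs_doubleDiff_le_of_local₂` — first- AND second-order locality of a map `K(·)` turn the displacements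
  `a` (along `d`), `b` (along `d′`) and the mixed remainder `c` (along `d + d′`) into a TWO-PROFILE pointwise row for
  `K(U+a+b+c) − K(U+a) − K(U+b) + K(U)`: `≤ (L·B·μ + L₂·B²·δ₁δ₂)·e^{2θr}·e^{−θ(d i + d′ i)}`.
* §3 ★★`abs_fourPt_trace_inv_mul_le_of_localMaps` — THE END-TO-END BOUND
  `|ΔΔ tr(K⁻¹H)| ≤ ((α·(L_H Vμ + L_H₂V²δ²) + α²η·(L_K Vμ + L_K₂V²δ²))·e^{2θr}·V·S_loc + 2α²·S_loc·S_dist·L_K(L_H + αηL_K)·(V²e^{2θr}δ)²)·s·t·e^{−(θ−θ₂)R}`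
  under: locality rows of `K, H`; the five displacement rows; Combes–Thomas rows `α, θ` of the four inverses (`CoerciveCombesThomas`,
  `coercive_combes_thomas_real`); `Σ|H(U₀₀)| ≤ η`; ball count `V`; separations `R ≤ d a + dist a b + d′ b`, `R ≤ d a + d′ a`; local sums.

WHY (consumer: cell `ym3-torus`, crux `FluctuationComparisonRegPrIntL`, the (I-curv) one-loop trace item of DISCHARGE-SPEC v1.8 §11 (xv)):
with this file the finite-dimensional MECHANISM of «second variation of `tr(K_V^{−1}H^O_V)` under two coarse one-bond moves is
`O(s·t·e^{−κ·tdist(b,b′)})`» is a kernel theorem whose displayed inputs are exactly the print-shaped ones — locality of the Hessians,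
localised first-order and mixed response of the background ([Balaban1985Variational] (10); tree `exists_branch_localisedResponse`,
`abs_mixedResponse_le`), decay of the propagator ([Balaban1984PropagatorsII] (1.33)) — and whose constants are local sums.
HONEST SCOPE: finite-dimensional bookkeeping; every row is a hypothesis; the m-uniformity of `α, θ, V, S_loc, S_dist, δ, μ` in the consumer's
indexing is the consumer's analysis, not this lemma's.  Nothing here bears on the Yang–Mills mass gap (Clay), which is NOT proved.

References: T. Bałaban, CMP 102 (1985) 277, Thm 1 (10) p. 279 [Balaban1985Variational]; CMP 96 (1984) 223, (1.33) [Balaban1984PropagatorsII];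
J. Glimm, A. Jaffe, *Quantum Physics* (1987) §18.2 [GlimmJaffe1987]; R. A. Horn, C. R. Johnson, *Matrix Analysis* (2013) §5.6 [HornJohnson2013].
-/

noncomputable section

open Matrix Finset
open scoped Matrix

namespace Literature.Analysis.Matrix

variable {n : Type*} [Fintype n] [DecidableEq n]

/-! ## §1 From pointwise profile rows with finite range to row∕column-summed rows -/

omit [DecidableEq n] in
/-- ROW sums from a pointwise row-profile bound and a finite range: if `|E a b| ≤ ε·e^{−θ·p a}`, `E a b ≠ 0 → dist a b ≤ r` and the
`r`-balls `{b | dist a b ≤ r}` have at most `V` elements, then `Σ_b |E a b| ≤ ε·V·e^{−θ·p a}`. [cite: HornJohnson2013, §5.6] -/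
theorem rowSum_le_of_profile_range (dist : n → n → ℕ) {E : Matrix n n ℝ} {ε θ : ℝ} (hε : 0 ≤ ε) {p : n → ℕ}
    (hE : ∀ a b, |E a b| ≤ ε * Real.exp (-(θ * p a))) {r : ℕ} (hEr : ∀ a b, E a b ≠ 0 → dist a b ≤ r)
    {V : ℕ} (hV : ∀ a, (univ.filter fun b => dist a b ≤ r).card ≤ V) (a : n) :
    ∑ b, |E a b| ≤ ε * V * Real.exp (-(θ * p a)) := by
  have hzero : ∀ b ∈ (univ : Finset n), b ∉ univ.filter (fun b => dist a b ≤ r) → |E a b| = 0 := by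
    intro b _ hb
    rw [Finset.mem_filter, not_and] at hb
    by_contra h
    exact hb (Finset.mem_univ b) (hEr a b (abs_ne_zero.mp h))
  rw [← Finset.sum_subset (Finset.subset_univ _) hzero]
  calc ∑ b ∈ univ.filter (fun b => dist a b ≤ r), |E a b|
      ≤ ∑ _b ∈ univ.filter (fun b => dist a b ≤ r), ε * Real.exp (-(θ * p a)) := Finset.sum_le_sum fun b _ => hE a b
    _ = ((univ.filter fun b => dist a b ≤ r).card : ℝ) * (ε * Real.exp (-(θ * p a))) := by
        rw [Finset.sum_const, nsmul_eq_mul]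
    _ ≤ (V : ℝ) * (ε * Real.exp (-(θ * p a))) := by
        have hc : ((univ.filter fun b => dist a b ≤ r).card : ℝ) ≤ V := by exact_mod_cast hV a
        exact mul_le_mul_of_nonneg_right hc (by positivity)
    _ = ε * V * Real.exp (-(θ * p a)) := by ring

omit [DecidableEq n] in
/-- COLUMN sums from a pointwise ROW-profile bound and a finite range: if `|E a b| ≤ ε·e^{−θ·p a}` (profile read at the ROW index),
`E a b ≠ 0 → dist a b ≤ r`, the profile is 1-Lipschitz (`p b ≤ dist a b + p a`), `θ ≥ 0`, and the transposed balls `{a | dist a b ≤ r}`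
have at most `V` elements, then `Σ_a |E a b| ≤ ε·V·e^{θr}·e^{−θ·p b}` (the profile moves to the column index at the price `e^{θr}`).
[cite: HornJohnson2013, §5.6] -/
theorem colSum_le_of_profile_range (dist : n → n → ℕ) {E : Matrix n n ℝ} {ε θ : ℝ} (hε : 0 ≤ ε) (hθ : 0 ≤ θ) {p : n → ℕ}
    (hp : ∀ a b, p b ≤ dist a b + p a)
    (hE : ∀ a b, |E a b| ≤ ε * Real.exp (-(θ * p a))) {r : ℕ} (hEr : ∀ a b, E a b ≠ 0 → dist a b ≤ r)
    {V : ℕ} (hV : ∀ b, (univ.filter fun a => dist a b ≤ r).card ≤ V) (b : n) :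
    ∑ a, |E a b| ≤ ε * V * Real.exp (θ * r) * Real.exp (-(θ * p b)) := by
  have hzero : ∀ a ∈ (univ : Finset n), a ∉ univ.filter (fun a => dist a b ≤ r) → |E a b| = 0 := by
    intro a _ ha
    rw [Finset.mem_filter, not_and] at ha
    by_contra h
    exact ha (Finset.mem_univ a) (hEr a b (abs_ne_zero.mp h))
  rw [← Finset.sum_subset (Finset.subset_univ _) hzero]
  have hterm : ∀ a ∈ univ.filter (fun a => dist a b ≤ r), |E a b| ≤ ε * (Real.exp (θ * r) * Real.exp (-(θ * p b))) := by
    intro a ha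
    rw [Finset.mem_filter] at ha
    refine (hE a b).trans (mul_le_mul_of_nonneg_left ?_ hε)
    rw [← Real.exp_add]
    refine Real.exp_le_exp.2 ?_
    have h1 : (p b : ℝ) ≤ dist a b + p a := by exact_mod_cast hp a b
    have h2 : (dist a b : ℝ) ≤ r := by exact_mod_cast ha.2
    nlinarith
  calc ∑ a ∈ univ.filter (fun a => dist a b ≤ r), |E a b|
      ≤ ∑ _a ∈ univ.filter (fun a => dist a b ≤ r), ε * (Real.exp (θ * r) * Real.exp (-(θ * p b))) := Finset.sum_le_sum hterm
    _ = ((univ.filter fun a => dist a b ≤ r).card : ℝ) * (ε * (Real.exp (θ * r) * Real.exp (-(θ * p b)))) := by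
        rw [Finset.sum_const, nsmul_eq_mul]
    _ ≤ (V : ℝ) * (ε * (Real.exp (θ * r) * Real.exp (-(θ * p b)))) := by
        have hc : ((univ.filter fun a => dist a b ≤ r).card : ℝ) ≤ V := by exact_mod_cast hV b
        exact mul_le_mul_of_nonneg_right hc (by positivity)
    _ = ε * V * Real.exp (θ * r) * Real.exp (-(θ * p b)) := by ring

/-! ## §2 Two-profile localisation of the DOUBLE difference of a local matrix-valued map -/

omit [DecidableEq n] in
/-- The mass of a TWO-PROFILE localised vector in an `r`-ball: `|v k| ≤ η·e^{−θ·(d k + d′ k)}` with `d, d′` 1-Lipschitz, `θ ≥ 0`,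
`#ball ≤ B` ⟹ `Σ_{k : dist i k ≤ r} |v k| ≤ B·η·e^{2θr}·e^{−θ·(d i + d′ i)}`. [cite: Balaban1985Variational, Thm 1 (10) p. 279] -/
theorem sum_ball_abs_le_twoProfile (dist : n → n → ℕ) {θ : ℝ} (hθ : 0 ≤ θ) {d d' : n → ℕ}
    (hd : ∀ i k, d i ≤ dist i k + d k) (hd' : ∀ i k, d' i ≤ dist i k + d' k)
    {v : n → ℝ} {η : ℝ} (hη : 0 ≤ η) (hv : ∀ k, |v k| ≤ η * Real.exp (-(θ * (d k + d' k))))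
    {r : ℕ} {B : ℝ} (i : n) (hB : ((univ.filter fun k => dist i k ≤ r).card : ℝ) ≤ B) :
    ∑ k ∈ univ.filter (fun k => dist i k ≤ r), |v k| ≤
      B * η * Real.exp (2 * θ * r) * Real.exp (-(θ * (d i + d' i))) := by
  have hterm : ∀ k ∈ univ.filter (fun k => dist i k ≤ r), |v k| ≤
      η * Real.exp (2 * θ * r) * Real.exp (-(θ * (d i + d' i))) := by
    intro k hk
    rw [Finset.mem_filter] at hk
    refine (hv k).trans ?_
    rw [mul_assoc, ← Real.exp_add]
    refine mul_le_mul_of_nonneg_left (Real.exp_le_exp.2 ?_) hη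
    have h1 : (d i : ℝ) ≤ dist i k + d k := by exact_mod_cast hd i k
    have h1' : (d' i : ℝ) ≤ dist i k + d' k := by exact_mod_cast hd' i k
    have h2 : (dist i k : ℝ) ≤ r := by exact_mod_cast hk.2
    nlinarith
  calc ∑ k ∈ univ.filter (fun k => dist i k ≤ r), |v k|
      ≤ ∑ _k ∈ univ.filter (fun k => dist i k ≤ r), η * Real.exp (2 * θ * r) * Real.exp (-(θ * (d i + d' i))) :=
        Finset.sum_le_sum hterm
    _ = ((univ.filter fun k => dist i k ≤ r).card : ℝ) * (η * Real.exp (2 * θ * r) * Real.exp (-(θ * (d i + d' i)))) := by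
        rw [Finset.sum_const, nsmul_eq_mul]
    _ ≤ B * (η * Real.exp (2 * θ * r) * Real.exp (-(θ * (d i + d' i)))) := mul_le_mul_of_nonneg_right hB (by positivity)
    _ = B * η * Real.exp (2 * θ * r) * Real.exp (-(θ * (d i + d' i))) := by ring

omit [DecidableEq n] in
/-- ★ **LOCALITY (orders 1 and 2) ⟹ TWO-PROFILE LOCALISED DOUBLE DIFFERENCE.**  Let `K : (n → ℝ) → Matrix n n ℝ` be local of radius `r`
with entrywise Lipschitz constant `L` (`|K U i j − K U′ i j| ≤ L·Σ_{k∈ball i} |U k − U′ k|`) and SECOND-ORDER constant `L₂`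
(`|K (U+a+b) i j − K (U+a) i j − K (U+b) i j + K U i j| ≤ L₂·(Σ_{k∈ball i} |a k|)·(Σ_{k∈ball i} |b k|)`).  Four configurations
`U, U + a, U + b, U + a + b + c` with `a` localised along `d` (`|a k| ≤ δ₁·e^{−θ·d k}`), `b` along `d′` (`δ₂`), and the MIXED remainder `c`
along both (`|c k| ≤ μ·e^{−θ·(d k + d′ k)}`), `r`-balls of cardinality `≤ B`.  Then every entry of the double difference is two-profile
localised: `|ΔΔK i j| ≤ (L·B·μ + L₂·B²·δ₁·δ₂)·e^{2θr}·e^{−θ·(d i + d′ i)}`. [cite: Balaban1985Variational, Thm 1 (10) p. 279] -/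
theorem abs_doubleDiff_le_of_local₂ (dist : n → n → ℕ) {K : (n → ℝ) → Matrix n n ℝ} {L L₂ : ℝ} {r : ℕ} (hL : 0 ≤ L) (hL₂ : 0 ≤ L₂)
    (hloc : ∀ U U' i j, |K U i j - K U' i j| ≤ L * ∑ k ∈ univ.filter (fun k => dist i k ≤ r), |U k - U' k|)
    (hloc₂ : ∀ U a b i j, |K (U + a + b) i j - K (U + a) i j - K (U + b) i j + K U i j| ≤
      L₂ * (∑ k ∈ univ.filter (fun k => dist i k ≤ r), |a k|) * (∑ k ∈ univ.filter (fun k => dist i k ≤ r), |b k|))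
    {θ : ℝ} (hθ : 0 ≤ θ) {d d' : n → ℕ} (hd : ∀ i k, d i ≤ dist i k + d k) (hd' : ∀ i k, d' i ≤ dist i k + d' k)
    {B : ℝ} (hB : ∀ i, ((univ.filter fun k => dist i k ≤ r).card : ℝ) ≤ B)
    {U a b c : n → ℝ} {δ₁ δ₂ μ : ℝ} (hδ₁ : 0 ≤ δ₁) (hδ₂ : 0 ≤ δ₂) (hμ : 0 ≤ μ)
    (ha : ∀ k, |a k| ≤ δ₁ * Real.exp (-(θ * d k))) (hb : ∀ k, |b k| ≤ δ₂ * Real.exp (-(θ * d' k)))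
    (hc : ∀ k, |c k| ≤ μ * Real.exp (-(θ * (d k + d' k)))) (i j : n) :
    |K (U + a + b + c) i j - K (U + a) i j - K (U + b) i j + K U i j| ≤
      (L * B * μ + L₂ * B ^ 2 * δ₁ * δ₂) * Real.exp (2 * θ * r) * Real.exp (-(θ * (d i + d' i))) := by
  have hB0 : 0 ≤ B := le_trans (Nat.cast_nonneg _) (hB i)
  -- split: `[K(U+a+b+c) − K(U+a+b)] + ΔΔ_{a,b} K(U)`
  have e : K (U + a + b + c) i j - K (U + a) i j - K (U + b) i j + K U i j =
      (K (U + a + b + c) i j - K (U + a + b) i j) + (K (U + a + b) i j - K (U + a) i j - K (U + b) i j + K U i j) := by ring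
  rw [e]
  refine (abs_add_le _ _).trans ?_
  -- the `c`-term
  have h1 : |K (U + a + b + c) i j - K (U + a + b) i j| ≤ L * (B * μ * Real.exp (2 * θ * r) * Real.exp (-(θ * (d i + d' i)))) := by
    refine (hloc _ _ i j).trans (mul_le_mul_of_nonneg_left ?_ hL)
    have hsum := sum_ball_abs_le_twoProfile dist hθ hd hd' hμ hc i (hB i)
    refine le_trans (le_of_eq (Finset.sum_congr rfl fun k _ => ?_)) hsum
    simp [add_sub_cancel_left]
  -- the `(a,b)`-term
  have hA := sum_ball_abs_le dist hθ hd hδ₁ ha i (hB i)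
  have hBb := sum_ball_abs_le dist hθ hd' hδ₂ hb i (hB i)
  have h2 : |K (U + a + b) i j - K (U + a) i j - K (U + b) i j + K U i j| ≤
      L₂ * (B * δ₁ * Real.exp (θ * r) * Real.exp (-(θ * d i))) * (B * δ₂ * Real.exp (θ * r) * Real.exp (-(θ * d' i))) := by
    refine (hloc₂ U a b i j).trans ?_
    have h0' : 0 ≤ B * δ₁ * Real.exp (θ * r) * Real.exp (-(θ * d i)) := by positivity
    exact mul_le_mul (mul_le_mul_of_nonneg_left hA hL₂) hBb (Finset.sum_nonneg fun k _ => abs_nonneg _)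
      (mul_nonneg hL₂ h0')
  have hexp : Real.exp (θ * r) * Real.exp (θ * r) = Real.exp (2 * θ * r) := by rw [← Real.exp_add]; ring_nf
  have hexp2 : Real.exp (-(θ * d i)) * Real.exp (-(θ * d' i)) = Real.exp (-(θ * (d i + d' i))) := by
    rw [← Real.exp_add]; ring_nf
  calc |K (U + a + b + c) i j - K (U + a + b) i j| + |K (U + a + b) i j - K (U + a) i j - K (U + b) i j + K U i j|
      ≤ L * (B * μ * Real.exp (2 * θ * r) * Real.exp (-(θ * (d i + d' i)))) +
          L₂ * (B * δ₁ * Real.exp (θ * r) * Real.exp (-(θ * d i))) * (B * δ₂ * Real.exp (θ * r) * Real.exp (-(θ * d' i))) :=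
        add_le_add h1 h2
    _ = (L * B * μ + L₂ * B ^ 2 * δ₁ * δ₂) * Real.exp (2 * θ * r) * Real.exp (-(θ * (d i + d' i))) := by
        rw [← hexp, ← hexp2]; ring


/-! ## §3 The rectangle END TO END from two local maps and four localised configurations -/

/-- ★★ **`ΔΔ tr(K(U)⁻¹H(U))` FROM LOCALITY AND LOCALISED RESPONSE, END TO END (card-free).**  Two matrix-valued maps `K, H` of a
configuration `U : n → ℝ`, local of radius `r` in the row index with first∕second-order constants `L_K, L_K₂`, `L_H, L_H₂` and values of
range `r`; four configurations `U₀₀, U₁₀, U₀₁, U₁₁` (the background at the corners of a coarse square) whose one-bond differences are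
localised along the 1-Lipschitz profiles `d` (size `δ·s`) and `d′` (size `δ·t`) and whose double difference is two-profile localised (size
`μ·s·t`) — the rows of the localised-response theorems (`LocalisedResponse`, `LogDetMixedDifferenceExpLocalised.exists_branch_localisedResponse`);
Combes–Thomas decay `α, θ` of the four inverses `K(U i j)⁻¹`; `Σ|H U₀₀| ≤ η`; ball count `V`, separation `R ≤ d a + dist a b + d′ b` and
`R ≤ d a + d′ a`, local sums `S_loc, S_dist` (`0 ≤ θ₂ ≤ θ`).  THEN, with `k := V²·e^{2θr}·δ`,
`|ΔΔ tr(K⁻¹H)| ≤ ( (α·(L_H·V·μ + L_H₂·V²·δ²) + α²·η·(L_K·V·μ + L_K₂·V²·δ²))·e^{2θr}·V·S_loc + 2·α²·S_loc·S_dist·L_K·(L_H + α·η·L_K)·k² )·s·t·e^{−(θ−θ₂)·R}`.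
PROOF: `LocalisedVariation.abs_sub_le_of_local_of_expLocalised` (first differences), `abs_doubleDiff_le_of_local₂` (double differences), §1
(pointwise + range ⟹ summed rows), `sum_sum_abs_le_of_twoProfile_range` (ℓ¹ rows), then `abs_fourPt_trace_inv_mul_le_of_summedProfiles`.
HONEST SCOPE: finite-dimensional bookkeeping; the locality of an actual Hessian, the response rows of an actual background and the
Combes–Thomas rows are hypotheses. [cite: Balaban1985Variational, Thm 1 (10) p. 279] [cite: GlimmJaffe1987, §18.2] -/
theorem abs_fourPt_trace_inv_mul_le_of_localMaps (dist : n → n → ℕ) (hds : ∀ a b, dist a b = dist b a)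
    {K H : (n → ℝ) → Matrix n n ℝ} {LK LK₂ LH LH₂ : ℝ} {r : ℕ}
    (hLK : 0 ≤ LK) (hLK₂ : 0 ≤ LK₂) (hLH : 0 ≤ LH) (hLH₂ : 0 ≤ LH₂)
    (hKloc : ∀ U U' i j, |K U i j - K U' i j| ≤ LK * ∑ k ∈ univ.filter (fun k => dist i k ≤ r), |U k - U' k|)
    (hKloc₂ : ∀ U a b i j, |K (U + a + b) i j - K (U + a) i j - K (U + b) i j + K U i j| ≤
      LK₂ * (∑ k ∈ univ.filter (fun k => dist i k ≤ r), |a k|) * (∑ k ∈ univ.filter (fun k => dist i k ≤ r), |b k|))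
    (hHloc : ∀ U U' i j, |H U i j - H U' i j| ≤ LH * ∑ k ∈ univ.filter (fun k => dist i k ≤ r), |U k - U' k|)
    (hHloc₂ : ∀ U a b i j, |H (U + a + b) i j - H (U + a) i j - H (U + b) i j + H U i j| ≤
      LH₂ * (∑ k ∈ univ.filter (fun k => dist i k ≤ r), |a k|) * (∑ k ∈ univ.filter (fun k => dist i k ≤ r), |b k|))
    (hKr : ∀ U a b, K U a b ≠ 0 → dist a b ≤ r) (hHr : ∀ U a b, H U a b ≠ 0 → dist a b ≤ r)
    {V : ℕ} (hV : ∀ a, (univ.filter fun b => dist a b ≤ r).card ≤ V)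
    {θ θ₂ : ℝ} (hθ₂ : 0 ≤ θ₂) (hθ₂θ : θ₂ ≤ θ)
    {d d' : n → ℕ} (hd : ∀ i k, d i ≤ dist i k + d k) (hd' : ∀ i k, d' i ≤ dist i k + d' k)
    {R : ℕ} (hsep : ∀ a b, R ≤ d a + dist a b + d' b) (hsep₂ : ∀ a, R ≤ d a + d' a)
    {Sloc Sdist : ℝ} (hSd : ∑ a, Real.exp (-(θ₂ * d a)) ≤ Sloc) (hSd' : ∑ a, Real.exp (-(θ₂ * d' a)) ≤ Sloc)
    (hSdi : ∀ a, ∑ b, Real.exp (-(θ₂ * dist a b)) ≤ Sdist) (hSdist0 : 0 ≤ Sdist)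
    {U₀₀ U₁₀ U₀₁ U₁₁ : n → ℝ} {δ μ s t : ℝ} (hδ : 0 ≤ δ) (hμ : 0 ≤ μ) (hs : 0 ≤ s) (ht : 0 ≤ t)
    (hD10 : ∀ k, |U₁₀ k - U₀₀ k| ≤ δ * s * Real.exp (-(θ * d k)))
    (hD11 : ∀ k, |U₁₁ k - U₀₁ k| ≤ δ * s * Real.exp (-(θ * d k)))
    (hD01 : ∀ k, |U₀₁ k - U₀₀ k| ≤ δ * t * Real.exp (-(θ * d' k)))
    (hD11' : ∀ k, |U₁₁ k - U₁₀ k| ≤ δ * t * Real.exp (-(θ * d' k)))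
    (hDD : ∀ k, |U₁₁ k - U₁₀ k - U₀₁ k + U₀₀ k| ≤ μ * s * t * Real.exp (-(θ * (d k + d' k))))
    (h₀₀ : (K U₀₀).det ≠ 0) (h₁₀ : (K U₁₀).det ≠ 0) (h₀₁ : (K U₀₁).det ≠ 0) (h₁₁ : (K U₁₁).det ≠ 0)
    {α : ℝ} (hα : 0 ≤ α)
    (hA₀₀ : ∀ x y, |(K U₀₀)⁻¹ x y| ≤ α * Real.exp (-(θ * dist x y)))
    (hA₁₀ : ∀ x y, |(K U₁₀)⁻¹ x y| ≤ α * Real.exp (-(θ * dist x y)))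
    (hA₀₁ : ∀ x y, |(K U₀₁)⁻¹ x y| ≤ α * Real.exp (-(θ * dist x y)))
    (hA₁₁ : ∀ x y, |(K U₁₁)⁻¹ x y| ≤ α * Real.exp (-(θ * dist x y)))
    {η : ℝ} (hη : ∑ x, ∑ y, |H U₀₀ x y| ≤ η) :
    |((K U₁₁)⁻¹ * H U₁₁).trace - ((K U₁₀)⁻¹ * H U₁₀).trace - ((K U₀₁)⁻¹ * H U₀₁).trace + ((K U₀₀)⁻¹ * H U₀₀).trace| ≤
      ((α * (LH * V * μ + LH₂ * V ^ 2 * δ ^ 2) + α ^ 2 * η * (LK * V * μ + LK₂ * V ^ 2 * δ ^ 2)) *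
            Real.exp (2 * θ * r) * V * Sloc +
          2 * α ^ 2 * Sloc * Sdist * LK * (LH + α * η * LK) * (V ^ 2 * Real.exp (2 * θ * r) * δ) ^ 2) *
        s * t * Real.exp (-((θ - θ₂) * R)) := by
  have hθ : 0 ≤ θ := hθ₂.trans hθ₂θ
  have hV0 : (0 : ℝ) ≤ V := Nat.cast_nonneg _
  have hVr : ∀ a, ((univ.filter fun b => dist a b ≤ r).card : ℝ) ≤ V := fun a => by exact_mod_cast hV a
  have hVc : ∀ b, (univ.filter fun a => dist a b ≤ r).card ≤ V := by
    intro b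
    have : (univ.filter fun a => dist a b ≤ r) = (univ.filter fun a => dist b a ≤ r) :=
      Finset.filter_congr fun a _ => by rw [hds a b]
    rw [this]; exact hV b
  have hηnn : 0 ≤ η := (Finset.sum_nonneg fun x _ => Finset.sum_nonneg fun y _ => abs_nonneg _).trans hη
  have hSloc0 : 0 ≤ Sloc := (Finset.sum_nonneg fun a _ => (Real.exp_pos _).le).trans hSd
  have her : Real.exp (θ * r) ≤ Real.exp (2 * θ * r) := Real.exp_le_exp.2 (by nlinarith [Nat.cast_nonneg (α := ℝ) r])
  -- profiles are 1-Lipschitz in the form §1 wants (`p b ≤ dist a b + p a`)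
  have hdp : ∀ a b, d b ≤ dist a b + d a := by intro a b; have := hd b a; rw [hds] at this; omega
  have hdp' : ∀ a b, d' b ≤ dist a b + d' a := by intro a b; have := hd' b a; rw [hds] at this; omega
  -- ranges of the differences
  have hKdr : ∀ U U' a b, (K U - K U') a b ≠ 0 → dist a b ≤ r := by
    intro U U' a b h
    rw [Matrix.sub_apply] at h
    by_cases h1 : K U a b = 0
    · exact hKr U' a b (by intro h2; exact h (by rw [h1, h2, sub_zero]))
    · exact hKr U a b h1
  have hHdr : ∀ U U' a b, (H U - H U') a b ≠ 0 → dist a b ≤ r := by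
    intro U U' a b h
    rw [Matrix.sub_apply] at h
    by_cases h1 : H U a b = 0
    · exact hHr U' a b (by intro h2; exact h (by rw [h1, h2, sub_zero]))
    · exact hHr U a b h1
  have hKddr : ∀ a b, (K U₁₁ - K U₁₀ - K U₀₁ + K U₀₀) a b ≠ 0 → dist a b ≤ r := by
    intro a b h
    simp only [Matrix.add_apply, Matrix.sub_apply] at h
    by_cases h1 : K U₁₁ a b = 0
    · by_cases h2 : K U₁₀ a b = 0
      · by_cases h3 : K U₀₁ a b = 0
        · exact hKr U₀₀ a b (by intro h4; exact h (by rw [h1, h2, h3, h4]; ring))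
        · exact hKr U₀₁ a b h3
      · exact hKr U₁₀ a b h2
    · exact hKr U₁₁ a b h1
  have hHddr : ∀ a b, (H U₁₁ - H U₁₀ - H U₀₁ + H U₀₀) a b ≠ 0 → dist a b ≤ r := by
    intro a b h
    simp only [Matrix.add_apply, Matrix.sub_apply] at h
    by_cases h1 : H U₁₁ a b = 0
    · by_cases h2 : H U₁₀ a b = 0
      · by_cases h3 : H U₀₁ a b = 0
        · exact hHr U₀₀ a b (by intro h4; exact h (by rw [h1, h2, h3, h4]; ring))
        · exact hHr U₀₁ a b h3
      · exact hHr U₁₀ a b h2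
    · exact hHr U₁₁ a b h1
  -- POINTWISE one-profile rows of the first differences (locality × localised displacement)
  have pK10 : ∀ i j, |(K U₁₀ - K U₀₀) i j| ≤ (LK * V * (δ * s) * Real.exp (θ * r)) * Real.exp (-(θ * d i)) := fun i j => by
    rw [Matrix.sub_apply]; exact abs_sub_le_of_local_of_expLocalised dist hLK hKloc hθ hd hVr (by positivity) hD10 i j
  have pK11 : ∀ i j, |(K U₁₁ - K U₀₁) i j| ≤ (LK * V * (δ * s) * Real.exp (θ * r)) * Real.exp (-(θ * d i)) := fun i j => by
    rw [Matrix.sub_apply]; exact abs_sub_le_of_local_of_expLocalised dist hLK hKloc hθ hd hVr (by positivity) hD11 i j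
  have pK01 : ∀ i j, |(K U₀₁ - K U₀₀) i j| ≤ (LK * V * (δ * t) * Real.exp (θ * r)) * Real.exp (-(θ * d' i)) := fun i j => by
    rw [Matrix.sub_apply]; exact abs_sub_le_of_local_of_expLocalised dist hLK hKloc hθ hd' hVr (by positivity) hD01 i j
  have pK11' : ∀ i j, |(K U₁₁ - K U₁₀) i j| ≤ (LK * V * (δ * t) * Real.exp (θ * r)) * Real.exp (-(θ * d' i)) := fun i j => by
    rw [Matrix.sub_apply]; exact abs_sub_le_of_local_of_expLocalised dist hLK hKloc hθ hd' hVr (by positivity) hD11' i j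
  have pH10 : ∀ i j, |(H U₁₀ - H U₀₀) i j| ≤ (LH * V * (δ * s) * Real.exp (θ * r)) * Real.exp (-(θ * d i)) := fun i j => by
    rw [Matrix.sub_apply]; exact abs_sub_le_of_local_of_expLocalised dist hLH hHloc hθ hd hVr (by positivity) hD10 i j
  have pH01 : ∀ i j, |(H U₀₁ - H U₀₀) i j| ≤ (LH * V * (δ * t) * Real.exp (θ * r)) * Real.exp (-(θ * d' i)) := fun i j => by
    rw [Matrix.sub_apply]; exact abs_sub_le_of_local_of_expLocalised dist hLH hHloc hθ hd' hVr (by positivity) hD01 i j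
  -- POINTWISE two-profile rows of the double differences
  have eU : U₀₀ + (U₁₀ - U₀₀) + (U₀₁ - U₀₀) + (U₁₁ - U₁₀ - U₀₁ + U₀₀) = U₁₁ ∧ U₀₀ + (U₁₀ - U₀₀) + (U₀₁ - U₀₀) = U₀₀ + (U₁₀ - U₀₀) + (U₀₁ - U₀₀)
      ∧ U₀₀ + (U₁₀ - U₀₀) = U₁₀ ∧ U₀₀ + (U₀₁ - U₀₀) = U₀₁ := by
    refine ⟨?_, rfl, ?_, ?_⟩ <;> (funext k; simp only [Pi.add_apply, Pi.sub_apply]; ring)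
  have pKK : ∀ i j, |(K U₁₁ - K U₁₀ - K U₀₁ + K U₀₀) i j| ≤
      ((LK * V * (μ * s * t) + LK₂ * V ^ 2 * (δ * s) * (δ * t)) * Real.exp (2 * θ * r)) * Real.exp (-(θ * (d i + d' i))) := by
    intro i j
    have h := abs_doubleDiff_le_of_local₂ dist hLK hLK₂ hKloc hKloc₂ hθ hd hd' hVr (U := U₀₀) (a := U₁₀ - U₀₀)
      (b := U₀₁ - U₀₀) (c := U₁₁ - U₁₀ - U₀₁ + U₀₀) (δ₁ := δ * s) (δ₂ := δ * t) (μ := μ * s * t) (by positivity) (by positivity)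
      (by positivity)
      (fun k => by simpa only [Pi.sub_apply] using hD10 k) (fun k => by simpa only [Pi.sub_apply] using hD01 k)
      (fun k => by simpa only [Pi.add_apply, Pi.sub_apply] using hDD k) i j
    rw [eU.1, eU.2.2.1, eU.2.2.2] at h
    simpa only [Matrix.add_apply, Matrix.sub_apply] using h
  have pHH : ∀ i j, |(H U₁₁ - H U₁₀ - H U₀₁ + H U₀₀) i j| ≤
      ((LH * V * (μ * s * t) + LH₂ * V ^ 2 * (δ * s) * (δ * t)) * Real.exp (2 * θ * r)) * Real.exp (-(θ * (d i + d' i))) := by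
    intro i j
    have h := abs_doubleDiff_le_of_local₂ dist hLH hLH₂ hHloc hHloc₂ hθ hd hd' hVr (U := U₀₀) (a := U₁₀ - U₀₀)
      (b := U₀₁ - U₀₀) (c := U₁₁ - U₁₀ - U₀₁ + U₀₀) (δ₁ := δ * s) (δ₂ := δ * t) (μ := μ * s * t) (by positivity) (by positivity)
      (by positivity)
      (fun k => by simpa only [Pi.sub_apply] using hD10 k) (fun k => by simpa only [Pi.sub_apply] using hD01 k)
      (fun k => by simpa only [Pi.add_apply, Pi.sub_apply] using hDD k) i j
    rw [eU.1, eU.2.2.1, eU.2.2.2] at h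
    simpa only [Matrix.add_apply, Matrix.sub_apply] using h
  -- SUMMED rows (range `r`, ball count `V`)
  set k₁ : ℝ := LK * (V : ℝ) ^ 2 * Real.exp (2 * θ * r) * δ with hk₁
  set h₁ : ℝ := LH * (V : ℝ) ^ 2 * Real.exp (2 * θ * r) * δ with hh₁
  have hk₁0 : 0 ≤ k₁ := by positivity
  have hh₁0 : 0 ≤ h₁ := by positivity
  -- helper: a row-profile pointwise bound with constant `c·e^{θr}` gives row sums `≤ c·V·e^{θr}` and column sums `≤ c·V·e^{2θr}`;
  -- both are `≤ (c·V·e^{2θr})`-rows.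
  have rowK : ∀ {E : Matrix n n ℝ} {L' q : ℝ} {p : n → ℕ}, 0 ≤ L' → 0 ≤ q →
      (∀ i j, |E i j| ≤ (L' * V * q * Real.exp (θ * r)) * Real.exp (-(θ * p i))) → (∀ a b, E a b ≠ 0 → dist a b ≤ r) →
      ∀ a, ∑ b, |E a b| ≤ (L' * (V : ℝ) ^ 2 * Real.exp (2 * θ * r) * q) * Real.exp (-(θ * p a)) := by
    intro E L' q p hL' hq hE hEr a
    have h := rowSum_le_of_profile_range dist (by positivity) hE hEr hV a
    refine h.trans ?_
    have h0 : 0 ≤ Real.exp (-(θ * p a)) := (Real.exp_pos _).le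
    have : L' * ↑V * q * Real.exp (θ * ↑r) * ↑V ≤ L' * ↑V ^ 2 * Real.exp (2 * θ * ↑r) * q := by
      have := mul_le_mul_of_nonneg_left her (by positivity : 0 ≤ L' * (V:ℝ) ^ 2 * q)
      nlinarith
    exact mul_le_mul_of_nonneg_right this h0
  have colK : ∀ {E : Matrix n n ℝ} {L' q : ℝ} {p : n → ℕ}, 0 ≤ L' → 0 ≤ q → (∀ a b, p b ≤ dist a b + p a) →
      (∀ i j, |E i j| ≤ (L' * V * q * Real.exp (θ * r)) * Real.exp (-(θ * p i))) → (∀ a b, E a b ≠ 0 → dist a b ≤ r) →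
      ∀ b, ∑ a, |E a b| ≤ (L' * (V : ℝ) ^ 2 * Real.exp (2 * θ * r) * q) * Real.exp (-(θ * p b)) := by
    intro E L' q p hL' hq hp hE hEr b
    have h := colSum_le_of_profile_range dist (by positivity) hθ hp hE hEr hVc b
    refine h.trans (le_of_eq ?_)
    have : Real.exp (θ * r) * Real.exp (θ * r) = Real.exp (2 * θ * r) := by rw [← Real.exp_add]; ring_nf
    rw [← this]; ring
  have hK1c0 := colK hLK (mul_nonneg hδ hs) hdp pK10 (hKdr U₁₀ U₀₀)
  have hK1c1 := colK hLK (mul_nonneg hδ hs) hdp pK11 (hKdr U₁₁ U₀₁)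
  have hK1r0 := rowK hLK (mul_nonneg hδ hs) pK10 (hKdr U₁₀ U₀₀)
  have hK2c1 := colK hLK (mul_nonneg hδ ht) hdp' pK11' (hKdr U₁₁ U₁₀)
  have hK2r0 := rowK hLK (mul_nonneg hδ ht) pK01 (hKdr U₀₁ U₀₀)
  have hH1r := rowK hLH (mul_nonneg hδ hs) pH10 (hHdr U₁₀ U₀₀)
  have hH2r := rowK hLH (mul_nonneg hδ ht) pH01 (hHdr U₀₁ U₀₀)
  -- ℓ¹ two-profile rows
  have hK12 := sum_sum_abs_le_of_twoProfile_range dist (η₀ := (LK * V * (μ * s * t) + LK₂ * V ^ 2 * (δ * s) * (δ * t)) *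
      Real.exp (2 * θ * r)) (by positivity) hθ₂ hθ₂θ pKK hKddr hV hsep₂ hSd
  have hH12 := sum_sum_abs_le_of_twoProfile_range dist (η₀ := (LH * V * (μ * s * t) + LH₂ * V ^ 2 * (δ * s) * (δ * t)) *
      Real.exp (2 * θ * r)) (by positivity) hθ₂ hθ₂θ pHH hHddr hV hsep₂ hSd
  -- the rectangle
  have main := abs_fourPt_trace_inv_mul_le_of_summedProfiles dist hds h₀₀ h₀₁ h₁₀ h₁₁
    (k₁ := k₁) (k₂ := k₁) (h₁ := h₁) (h₂ := h₁)
    (k₁₂ := (LK * V * μ + LK₂ * V ^ 2 * δ ^ 2) * Real.exp (2 * θ * r) * V * Sloc)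
    (h₁₂ := (LH * V * μ + LH₂ * V ^ 2 * δ ^ 2) * Real.exp (2 * θ * r) * V * Sloc)
    hα hk₁0 hk₁0 hh₁0 hh₁0 hs ht hθ₂ hθ₂θ hSdist0 hA₀₀ hA₀₁ hA₁₀ hA₁₁ hsep hSd hSd' hSdi
    (fun b => by have := hK1c0 b; rw [hk₁]; convert this using 1; ring)
    (fun b => by have := hK1c1 b; rw [hk₁]; convert this using 1; ring)
    (fun a => by have := hK1r0 a; rw [hk₁]; convert this using 1; ring)
    (fun b => by have := hK2c1 b; rw [hk₁]; convert this using 1; ring)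
    (fun a => by have := hK2r0 a; rw [hk₁]; convert this using 1; ring)
    (by convert hK12 using 1; ring) hη
    (fun a => by have := hH1r a; rw [hh₁]; convert this using 1; ring)
    (fun a => by have := hH2r a; rw [hh₁]; convert this using 1; ring)
    (by convert hH12 using 1; ring)
  refine main.trans (le_of_eq ?_)
  rw [hk₁, hh₁]; ring

end Literature.Analysis.Matrix

end
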